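import Summits.ABC.IUTFork.Thm311RealInd1UnitsBaseLineMover
import HarnessLib

/-!
# The unit-group shear at `v₇ = (√7)` of `ℚ(√7)`, VI: the HOSHI–NISHIO UNIPOTENT FAMILY — the d = 2
# print input of Thm 1.5, its normal form, and the `μ·U^{(2)}` valuation dichotomy

Record file (D-0012) of the abc-iut cell (TEAM R, lead seat abc-iut-c312-14 = R1, gen 9; row
«R9f-HN-UNIPOTENT», claimed plan/C312-TEAMS.md 2026-08-27T00:29:30Z on abc-iut-lit gen 10's
00:02:34Z/00:07:02Z acq-11631-served find).  Sequel of `Thm311RealInd1UnitsBaseLineMover.lean`.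
TAKES NO SIDE on [IUTchIII] Cor. 3.12.

BACKGROUND.  GAP-LEDGER row G-c312-14-R9f (open step (ii) of disposition D-G-c312-14-R9f): does the
automorphism `*α ∈ Aut(G_k)` of Hoshi–Nishio move `μ·U^{(2)}`?  The primary source is now HELD
(RIMS Preprint 1931 revised = Res. Number Theory 8 (2022) no. 56; item map
`HOSHI-NISHIO-2022-RIMS1931-ITEMS.md`): Theorem 1.5 (p. 5 l. 25–31) gives, for any group `G` of
MLF-type with `p(G)` odd and `d(G) > 1`, automorphisms `*α^n` of `G` whose induced maps on
`k_+(G)` satisfy `*α^n_+ ≠ id` and `(*α^n_+ − id)² = 0` (UNIPOTENT, acting on the Lemma 1.3 basis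
by the elementary transvection `y_{d} ↦ y_{d} + n·y_{d−1}`, proof sentence p. 5 l. 34–36);
Lemma 2.3 (ii) (p. 7 l. 21–33) makes every induced `α_+` commute with `Tr_{k/ℚ_p}` and preserve
`Ker Tr`; Lemma 2.4 (p. 8 l. 22–24) makes `*α^n` at `d_k = 2` never `(ℚ_{p_k})_+`-characteristic —
the base line `ℚ_p·1` MOVES.  At `d = 2` a unipotent `≠ id` endomorphism has exactly one invariant
line, so the print data pin the SHAPE completely: in the basis `{1, Ω}` of `K₇ = ℚ₇(√7)` the map is
`x + y·Ω ↦ x + (y + c·x)·Ω` for a single scalar `c ≠ 0` — whose VALUATION the text does not pin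
(abc-iut-lit gen 10, desk consequence of 00:07:02Z, re-derived in kernel here as asked).

THIS PAIR OF FILES (this one + the sequel `Thm311RealInd1UnitsHNDichotomy.lean`, split per the
≤400-line proof-file rule) types that family over the landed chain (p466991 Core · p468895
Analytic · p469019 Shear · p469277 Strip · p476108 BaseLineMover) and proves — the items from
`psiHN` onwards live in the SEQUEL:

* `hnLin c` — the transvection `x ↦ x + (c·(repr x 0))·Ω`, with the PRINT-SHAPE laws:
  `hnLin_sub_id_sq` ((T − id)² = 0, Thm 1.5's display), `hnLin_hnLin`/`hnLin_pow` (the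
  one-parameter law `T_c ∘ T_{c'} = T_{c+c'}`, `T_c^n = T_{n·c}` — the proof-sentence scaling
  `c_n = n·c₁`), `hnLin_ne_id_iff` (`≠ id ↔ c ≠ 0`), `repr_hnLin` (coordinate 0 preserved — the
  Lemma 2.3 (ii) trace compatibility: `Tr = 2·coord₀` in `{1, Ω}`), `hnLin_smul_omega` (the
  `Ker Tr`-line `ℚ₇·Ω` is fixed POINTWISE), and `hnLin_ne_glin` (the family is disjoint from the
  landed involution class: `hnLin` has unipotent defect, `glin` has `d∘d = −2·d` — the two located
  print inputs, RIMS-1931 Thm 1.5 and RIMS-1960 Lemma 3.1 (v), are kernel-separated classes, the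
  complement of p476108's `exists_shearDefect_shearDefect_ne_one`);
* `eq_hnLin_of_unipotent_of_line` — NORMAL FORM: EVERY `ℚ₇`-linear `T` with `(T − id)² = 0` that
  maps the line `ℚ₇·Ω` to itself IS `hnLin c` for some `c`: the Thm 1.5 + Lemma 2.3 (ii) data
  characterise the family up to the one scalar `c`;
* `psiHN c` — the realisation on `K_{v₇}` (mirror of `psiShear`), with `psiHN_moves_baseSeg`
  (EVERY `c ≠ 0` moves the base-line target `baseSeg` — the kernel mirror of Lemma 2.4) and
  **`psiHN_image_M2_iff`** — THE DICHOTOMY: `psiHN c` fixes the landed `μ·U^{(2)}`-target `M₂`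
  **iff `‖c‖ ≤ 1`** (parity threshold); hence `hn_family_M2_dichotomy` — BOTH horns are realised
  inside the print-allowed family (`c = 1` preserves, `c = 7⁻¹` moves): whether Hoshi–Nishio's
  `*α` moves `μ·U^{(2)}` is exactly the valuation of its shear scalar, a datum Thm 1.5 +
  Lemmas 2.3/2.4 leave free — «undecided by the held text», now a kernel statement;
* `exists_pow_psiHN_image_M2_eq` — the `p^m`-tail: for every `c` some `7^m` makes all `T_{n·c}`
  with `7^m ∣ n` fix `M₂` (print's `*α^n` at high `p`-divisibility preserves any fixed lattice);
* `print_shape_adjudication` — the packaged step-(ii) adjudication: every print-shaped `T` is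
  `hnLin c` with `c ≠ 0`, its realisation moves `baseSeg`, and it fixes `M₂` iff `‖c‖ ≤ 1`;
* strip wiring (hypotheses INLINE per D-0067, no new Prop facts): `psiHN_mem_ind1StripOf`,
  `ind1_strip_moves_baseSeg_of_hnRealised`, `ind1_strip_moves_M2_of_hnRealised` — the conditional
  (Ind1)-movers with the HN-realisation hypothesis `Realises v₇ L₇ (stripMulAut v₇ φ) (psiHN c)`.

NOTE OF RECORD (aud-11 n1, 2026-08-27T00:08:20Z, accepted): where this chain identifies Hoshi's
functoriality reference with [AbsTopIII] Prop. 3.2 (iv), that identification is the TREE'S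
interpretive gloss — Hoshi–Nishio's own reference is [4, Prop. 3.11 (iv)] = Y. Hoshi,
*Introduction to mono-anabelian geometry*, Publ. Math. Besançon (2021), Prop. 3.11 (iv); the
realisation hypotheses below are stated abstractly (`Realises`) and do not depend on the gloss.

[cite: HoshiNishio2022OuterAutMLF, Thm 1.5 p.5 l.25–31; Lem 2.3 (ii) p.7 l.21–33; Lem 2.4 p.8
l.22–24 (RIMS-1931 rev.)] [cite: NeukirchSchmidtWingberg2008, Thm 7.5.14–7.5.15 (the
Jannsen–Wingberg presentation behind `*α`)] [cite: Hoshi2024IntrinsicHodgeTate, Lemma 3.1 (v)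
pp.10–11 (the separated involution-class input)] [cite: MochizukiAbsAnab2004, Prop 1.2.1 (iii)
p.10] [claim: Mochizuki2012, status: disputed] for every [IUTchIII] locution.  Consumed BY NAME,
nothing restated: the UnitsShear chain (R1 g7/g8), `IsmDHMover.norm_padic_le_zpow_iff` (w5-d216),
`Realises`/`stripMulAut`/`ind1StripOf` (c312-1).  Nothing here asserts or refutes [IUTchIII]
Cor. 3.12; typed ≠ proved; cited ≠ endorsed.
-/

set_option autoImplicit false

noncomputable section

namespace Summit.ABC.IUTFork.Thm311.Real.UnitsShear

open Literature.IUT.LogVolume Literature.NumberTheory.NumberFields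
open NumberField IsDedekindDomain Metric IsUltrametricDist
open Summit.ABC.IUTFork.RamifiedMover
open Summit.ABC.IUTFork.Thm311.Real

/-! ## 1. The Hoshi–Nishio transvection family `T_c` and its print-shape laws -/

/-- **The Hoshi–Nishio transvection `T_c`**: `x ↦ x + (c·(repr x 0))·Ω` — in the basis `{1, Ω}`,
`x + y·Ω ↦ x + (y + c·x)·Ω`.  This is the `d = 2` shape of the map `*α^n_+` of [HN] Thm 1.5
(elementary transvection on the Lemma 1.3 basis, proof sentence p.5 l.34–36), with the scalar `c`
NOT pinned by the print.  [cite: HoshiNishio2022OuterAutMLF, Thm 1.5 p.5 l.25–36] -/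
def hnLin (c : ℚ_[7]) : K7 →ₗ[ℚ_[7]] K7 :=
  LinearMap.id + c • (bs7.coord 0).smulRight Omega

/-- `T_c` applied. [folklore] -/
theorem hnLin_apply (c : ℚ_[7]) (x : K7) :
    hnLin c x = x + (c * bs7.repr x 0) • Omega := by
  simp only [hnLin, LinearMap.add_apply, LinearMap.id_apply, LinearMap.smul_apply,
    LinearMap.smulRight_apply, Module.Basis.coord_apply, smul_smul]

/-- Coordinates of `T_c x`: coordinate `0` is PRESERVED (this is [HN] Lem 2.3 (ii)'s trace
compatibility at `k = K₇`: the field trace is `2·coord₀` in the basis `{1, Ω}`), coordinate `1`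
is sheared by `c·(coord₀ x)`. [cite: HoshiNishio2022OuterAutMLF, Lem 2.3 (ii) p.7 l.21–33] -/
theorem repr_hnLin (c : ℚ_[7]) (x : K7) :
    bs7.repr (hnLin c x) 0 = bs7.repr x 0 ∧
      bs7.repr (hnLin c x) 1 = bs7.repr x 1 + c * bs7.repr x 0 := by
  rw [hnLin_apply]
  constructor
  · rw [map_add, Finsupp.add_apply, (repr_smul_omega _).1, add_zero]
  · rw [map_add, Finsupp.add_apply, (repr_smul_omega _).2]

/-- **The `Ker Tr`-line `ℚ₇·Ω` is fixed POINTWISE by every `T_c`** — the `d = 2` consequence of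
unipotency + [HN] Lem 2.3 (ii) (a non-identity unipotent map of a plane fixes its unique invariant
line pointwise, and `Ker Tr` is invariant). [cite: HoshiNishio2022OuterAutMLF, Lem 2.3 (ii)] -/
theorem hnLin_smul_omega (c b : ℚ_[7]) : hnLin c (b • Omega) = b • Omega := by
  rw [hnLin_apply, (repr_smul_omega b).1, mul_zero, zero_smul, add_zero]

/-- `T_c Ω = Ω`. [folklore] -/
theorem hnLin_omega (c : ℚ_[7]) : hnLin c Omega = Omega := by
  have h := hnLin_smul_omega c 1
  rwa [one_smul] at h

/-- `T_c 1 = 1 + c·Ω` — the base point `1` is sheared toward the `Ω`-line. [folklore] -/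
theorem hnLin_one (c : ℚ_[7]) : hnLin c (1 : K7) = 1 + c • Omega := by
  rw [hnLin_apply, repr_one.1, mul_one]

/-- **UNIPOTENCY, [HN] Thm 1.5's display: `(T_c − id)² = 0`.**  Contrast the landed involution
class: `dlin ∘ dlin = −2·dlin ≠ 0` (`Thm311RealInd1UnitsShearCore.dlin_dlin`).
[cite: HoshiNishio2022OuterAutMLF, Thm 1.5 p.5 l.25–31] -/
theorem hnLin_sub_id_sq (c : ℚ_[7]) :
    (hnLin c - LinearMap.id) ∘ₗ (hnLin c - LinearMap.id) = 0 := by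
  refine LinearMap.ext fun x => ?_
  have hinner : (hnLin c - (LinearMap.id : K7 →ₗ[ℚ_[7]] K7)) x = (c * bs7.repr x 0) • Omega := by
    rw [LinearMap.sub_apply, LinearMap.id_apply, hnLin_apply, add_sub_cancel_left]
  rw [LinearMap.comp_apply, hinner, LinearMap.sub_apply, LinearMap.id_apply,
    hnLin_smul_omega, sub_self, LinearMap.zero_apply]

/-- **The one-parameter law `T_c ∘ T_{c'} = T_{c+c'}`** (pointwise form). [folklore] -/
theorem hnLin_hnLin (c c' : ℚ_[7]) (x : K7) :
    hnLin c (hnLin c' x) = hnLin (c + c') x := by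
  rw [hnLin_apply c (hnLin c' x), (repr_hnLin c' x).1, hnLin_apply c' x,
    hnLin_apply (c + c') x, add_assoc, ← add_smul,
    show c' * bs7.repr x 0 + c * bs7.repr x 0 = (c + c') * bs7.repr x 0 by ring]

/-- The one-parameter law, composition form. [folklore] -/
theorem hnLin_comp (c c' : ℚ_[7]) : (hnLin c) ∘ₗ (hnLin c') = hnLin (c + c') :=
  LinearMap.ext fun x => hnLin_hnLin c c' x

/-- `T_0 = id`. [folklore] -/
theorem hnLin_zero : hnLin 0 = LinearMap.id := by
  refine LinearMap.ext fun x => ?_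
  rw [hnLin_apply, zero_mul, zero_smul, add_zero, LinearMap.id_apply]

/-- **The power law `T_c^n = T_{n·c}`** — the print's `*α^n` scaling `c_n = n·c₁` ([HN] Thm 1.5
proof sentence `y_d ↦ y_d + n·y_{d−1}`, p.5 l.34–36): the `n`-th power of the generator moves by
`n` times the base scalar. [cite: HoshiNishio2022OuterAutMLF, Thm 1.5 p.5 l.34–36] -/
theorem hnLin_pow (c : ℚ_[7]) (n : ℕ) : (hnLin c) ^ n = hnLin ((n : ℚ_[7]) * c) := by
  induction n with
  | zero =>
      rw [pow_zero, Nat.cast_zero, zero_mul, hnLin_zero]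
      exact Module.End.one_eq_id
  | succ k ih =>
      have h : (k : ℚ_[7]) * c + c = ((k + 1 : ℕ) : ℚ_[7]) * c := by push_cast; ring
      rw [pow_succ, ih]
      refine LinearMap.ext fun x => ?_
      rw [Module.End.mul_apply, hnLin_hnLin, h]

/-- **`T_c ≠ id ↔ c ≠ 0`** — [HN] Thm 1.5's `*α^n_+ ≠ id`, both directions. [cite:
HoshiNishio2022OuterAutMLF, Thm 1.5 p.5 l.25–31] -/
theorem hnLin_ne_id_iff (c : ℚ_[7]) : hnLin c ≠ LinearMap.id ↔ c ≠ 0 := by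
  constructor
  · intro h hc
    exact h (by rw [hc, hnLin_zero])
  · intro hc h
    have h1 : hnLin c (1 : K7) = (1 : K7) := by rw [h, LinearMap.id_apply]
    rw [hnLin_one] at h1
    have h2 : c • Omega = 0 := by
      have h4 : (1 : K7) + c • Omega - 1 = 1 - 1 := by rw [h1]
      rwa [add_sub_cancel_left, sub_self] at h4
    rcases smul_eq_zero.mp h2 with h3 | h3
    · exact hc h3
    · exact norm_pos_iff.mp norm_omega_pos_lt_one.1 h3

/-- `δ(Ω) = −2` for the LANDED shear-reflection coefficient. [folklore] -/
theorem dcoef_omega : dcoef Omega = -2 := by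
  rw [dcoef, repr_omega.1, repr_omega.2]
  norm_num

/-- **CLASS SEPARATION**: no member of the unipotent family is the landed shear-reflection `g` —
`T_c Ω = Ω` while `g Ω = −Ω`.  Together with p476108's `exists_shearDefect_shearDefect_ne_one`
this kernel-separates the two located print inputs: [HN] Thm 1.5 (unipotent, `(T−id)² = 0`) and
Hoshi RIMS-1960 Lem 3.1 (v)'s involution class (`d∘d = −2·d`).
[cite: Hoshi2024IntrinsicHodgeTate, Lemma 3.1 (v) pp.10–11] -/
theorem hnLin_ne_glin (c : ℚ_[7]) : hnLin c ≠ glin := by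
  intro h
  have h1 : hnLin c Omega = glin Omega := by rw [h]
  rw [hnLin_omega, glin_apply, dcoef_omega] at h1
  nth_rewrite 1 [← add_zero Omega] at h1
  have h2 := add_left_cancel h1
  rcases smul_eq_zero.mp h2.symm with h3 | h3
  · norm_num at h3
  · exact norm_pos_iff.mp norm_omega_pos_lt_one.1 h3

/-! ## 2. Normal form: the print constraints characterise the family -/

/-- Linear independence of `{1, Ω}` in coefficient form. [folklore] -/
theorem combo_eq_zero {u v : ℚ_[7]} (h : u • (1 : K7) + v • Omega = 0) : u = 0 ∧ v = 0 := by
  have h0 := (repr_combo u v).1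
  have h1 := (repr_combo u v).2
  rw [h] at h0 h1
  simp only [map_zero, Finsupp.coe_zero, Pi.zero_apply] at h0 h1
  exact ⟨h0.symm, h1.symm⟩

/-- **NORMAL FORM**: every `ℚ₇`-linear endomorphism `T` of `K₇` with `(T − id)² = 0` ([HN]
Thm 1.5's display) that maps the line `ℚ₇·Ω = Ker Tr` to itself ([HN] Lem 2.3 (ii)) IS `hnLin c`
for some scalar `c` — the print constraints determine the map up to the ONE scalar the text does
not pin.  [cite: HoshiNishio2022OuterAutMLF, Thm 1.5 p.5 l.25–31; Lem 2.3 (ii) p.7 l.21–33] -/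
theorem eq_hnLin_of_unipotent_of_line {T : K7 →ₗ[ℚ_[7]] K7}
    (hunip : (T - LinearMap.id) ∘ₗ (T - LinearMap.id) = 0)
    (hline : ∃ s : ℚ_[7], T Omega = s • Omega) :
    ∃ c : ℚ_[7], T = hnLin c := by
  obtain ⟨s, hs⟩ := hline
  -- the unfolded unipotency: `T (T y − y) − (T y − y) = 0` for every `y`.
  have hunip' : ∀ y : K7, T (T y - y) - (T y - y) = 0 := by
    intro y
    have h := LinearMap.ext_iff.mp hunip y
    rwa [LinearMap.comp_apply, LinearMap.sub_apply, LinearMap.id_apply, LinearMap.sub_apply,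
      LinearMap.id_apply, LinearMap.zero_apply] at h
  -- Step A: the scalar on the invariant line is 1.
  have hsone : s = 1 := by
    have h2 := hunip' Omega
    have h3 : s • Omega - Omega = (s - 1) • Omega := by rw [sub_smul, one_smul]
    rw [hs, h3, map_smul, hs, smul_smul, ← sub_smul] at h2
    rcases smul_eq_zero.mp h2 with h4 | h4
    · have h5 : (s - 1) * (s - 1) = 0 := by
        have h6 : (s - 1) * s - (s - 1) = (s - 1) * (s - 1) := by ring
        rwa [h6] at h4
      exact sub_eq_zero.mp (mul_self_eq_zero.mp h5)
    · exact absurd h4 (norm_pos_iff.mp norm_omega_pos_lt_one.1)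
  have hTOmega : T Omega = Omega := by rw [hs, hsone, one_smul]
  -- Step B: name the coordinates of `T 1` opaquely.
  set a := bs7.repr (T 1) 0 with ha
  set b := bs7.repr (T 1) 1 with hb
  have hT1 : T 1 = a • (1 : K7) + b • Omega := decomp (T 1)
  -- Step C: the base coordinate is 1.
  have haone : a = 1 := by
    have hTu : T (T 1 - 1) = T 1 - 1 := sub_eq_zero.mp (hunip' (1 : K7))
    have hu : T (1 : K7) - 1 = (a - 1) • (1 : K7) + b • Omega := by
      have h0 := decomp (T 1 - 1)
      rw [map_sub, Finsupp.sub_apply, Finsupp.sub_apply, repr_one.1, repr_one.2, sub_zero,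
        ← ha, ← hb] at h0
      exact h0
    have hT1' : T (T 1 - 1) = (a - 1) • T 1 + b • Omega := by
      rw [hu, map_add, map_smul, map_smul, hTOmega]
    have h3 : (a - 1) • T 1 + b • Omega = (a - 1) • (1 : K7) + b • Omega := by
      rw [← hT1', hTu, hu]
    have h4 : (a - 1) • T 1 = (a - 1) • (1 : K7) := add_right_cancel h3
    have h5 : (a - 1) * a = a - 1 := by
      have h6 : bs7.repr ((a - 1) • T 1) 0 = bs7.repr ((a - 1) • (1 : K7)) 0 := by rw [h4]
      rw [map_smul, Finsupp.smul_apply, map_smul, Finsupp.smul_apply, repr_one.1, smul_eq_mul,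
        smul_eq_mul, mul_one, ← ha] at h6
      exact h6
    have h7 : (a - 1) * (a - 1) = 0 := by
      have h8 : (a - 1) * (a - 1) = (a - 1) * a - (a - 1) := by ring
      rw [h8, h5, sub_self]
    exact sub_eq_zero.mp (mul_self_eq_zero.mp h7)
  rw [haone, one_smul] at hT1
  -- Step D: `T = hnLin b` on coordinates.
  refine ⟨b, LinearMap.ext fun x => ?_⟩
  rw [hnLin_apply]
  set a0 := bs7.repr x 0 with ha0
  set a1 := bs7.repr x 1 with ha1
  have hx : x = a0 • (1 : K7) + a1 • Omega := by
    have h9 := decomp x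
    rwa [← ha0, ← ha1] at h9
  conv_lhs => rw [hx]
  rw [map_add, map_smul, map_smul, hT1, hTOmega]
  conv_rhs => rw [hx]
  rw [smul_add, smul_smul, mul_comm a0 b, add_right_comm]

end Summit.ABC.IUTFork.Thm311.Real.UnitsShear

end
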